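import Literature.Analysis.FunctionSpaces.PVFunctionsProofs
import Literature.Analysis.FunctionSpaces.PVToolkitArith
import Literature.Computability.Complexity.PlumbingBricks
import Literature.Computability.Complexity.PRelHierarchy
import Literature.Computability.Complexity.BinarySubtraction
import Literature.Computability.Complexity.TM2PassThrough
import HarnessLib

/-!
# From Cobham's class to `FP` string functions: string numbers and the bridge

A string function `g : {0,1}* → {0,1}*` is obtained from a number-theoretic function `F : ℕ → ℕ` in
Cobham's class (`PV₁ F`, i.e. `IsPVDefinable`) by coding strings as **string numbers**
`sn w = ⟦w 1⟧ = bitsToNat (w ++ [1])` (the binary notation of `sn w` is `w` followed by a leading `1`, so `w ↦ sn w` is a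
bijection `{0,1}* ≃ ℕ_{>0}` and `|sn w| = |w| + 1`): `g = unsn ∘ F ∘ sn`, where on strings
`sn` is "append `1`" and `unsn` is "drop the last symbol".  By Cobham's theorem, "if" direction
(`PVPoly.onCodes_eval`, `PVFunctionsProofs.lean`), `F` is computed on numerals by an `FP` function, so
`g ∈ FP` (`strFn_mem_FP`), and `g w = t` whenever `F (sn w) = sn t` (`strFn_apply`).  This is how the
machine level of the PCP theorem is discharged: the gap-producing map is DEFINED and proved
polynomial-time as a function on string numbers inside Cobham's class.

* `sn`, `unsn`, `sn_injective`, `encodeNat_sn`, `unsn_sn`, `size_sn`, `sn_pos`, `sn_eq`;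
* `exists_fp_of_pv₁` — an `FP` numeral function for every `PV₁` function;
* `strFn F`, **`strFn_mem_FP`**, **`strFn_apply`**.

## References

* A. Cobham, *The intrinsic computational difficulty of functions*, 1965 (the theorem used).
* S. Arora, B. Barak, *Computational Complexity: A Modern Approach*, CUP 2009, §1.3.
-/

namespace Literature.Computability.Complexity

open _root_.Computability Literature.Analysis.FunctionSpaces

/-! ### String numbers -/

/-- **The string number** `sn w = ⟦w 1⟧`: the number whose binary notation (least significant bit
first) is `w` followed by `1`. [folklore] -/
def sn (w : List Bool) : ℕ := bitsToNat (w ++ [true])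

/-- The numeral of `sn w` is `w 1`. [folklore] -/
theorem encodeNat_sn (w : List Bool) : encodeNat (sn w) = w ++ [true] :=
  encodeNat_bitsToNat (isCanonicalNum_append_true w)

/-- `sn` is injective. [folklore] -/
theorem sn_injective : Function.Injective sn := fun a b h => by
  have := congrArg encodeNat h
  rw [encodeNat_sn, encodeNat_sn] at this
  exact List.append_cancel_right this

/-- `sn w = ⟦w⟧ + 2^{|w|}`. [folklore] -/
theorem sn_eq (w : List Bool) : sn w = bitsToNat w + 2 ^ w.length := by
  unfold sn; rw [bitsToNat_append]; simp [bitsToNat]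

/-- `sn w > 0`. [folklore] -/
theorem sn_pos (w : List Bool) : 0 < sn w := by rw [sn_eq]; positivity

/-- `|sn w| = |w| + 1`. [folklore] -/
theorem size_sn (w : List Bool) : (sn w).size = w.length + 1 := by
  have h := congrArg List.length (encodeNat_sn w)
  rw [List.length_append, List.length_singleton, TM2Pass.length_encodeNat_eq_size] at h
  exact h

/-- **Inverse**: drop the last symbol of the numeral. [folklore] -/
def unsn (m : ℕ) : List Bool := (encodeNat m).dropLast

/-- `unsn (sn w) = w`. [folklore] -/
@[simp] theorem unsn_sn (w : List Bool) : unsn (sn w) = w := by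
  unfold unsn; rw [encodeNat_sn, List.dropLast_concat]

/-! ### The bridge -/

/-- **An `FP` numeral function for every function of Cobham's class** (Cobham's theorem, "if").
[cite: Cobham1965] -/
theorem exists_fp_of_pv₁ {F : ℕ → ℕ} (hF : PV₁ F) : ∃ G : List Bool → List Bool, G ∈ FP ∧ ∀ a, G (encodeNat a) = encodeNat (F a) := by
  obtain ⟨f, hf⟩ := hF
  obtain ⟨φ, hφ, hφv⟩ := PVPoly.onCodes_eval f
  refine ⟨φ ∘ fanoutFn id (fun _ => []), comp_mem_FP hφ (fanoutFn_mem_FP (PolyTimeComputable.id _) (const_mem_FP [])), fun a => ?_⟩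
  have hcode : fanoutFn id (fun _ => []) (encodeNat a) = PVPoly.codeVec (fun _ : Fin 1 => a) := by
    rw [fanoutFn_apply, PVPoly.codeVec_succ, PVPoly.codeVec_zero]; rfl
  simp only [Function.comp_apply]
  rw [hcode, hφv, hf]

/-- The `FP` numeral function of `F`. [cite: Cobham1965] -/
noncomputable def numFn {F : ℕ → ℕ} (hF : PV₁ F) : List Bool → List Bool := (exists_fp_of_pv₁ hF).choose

/-- `numFn F ∈ FP`. [cite: Cobham1965] -/
theorem numFn_mem_FP {F : ℕ → ℕ} (hF : PV₁ F) : numFn hF ∈ FP := (exists_fp_of_pv₁ hF).choose_spec.1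

/-- `numFn F` computes `F` on numerals. [cite: Cobham1965] -/
theorem numFn_encodeNat {F : ℕ → ℕ} (hF : PV₁ F) (a : ℕ) : numFn hF (encodeNat a) = encodeNat (F a) := (exists_fp_of_pv₁ hF).choose_spec.2 a

/-- Appending the marker `1`: `w ↦ w 1 = encodeNat (sn w)`. [folklore] -/
def snFn : List Bool → List Bool := fun w => w ++ [true]

/-- `snFn ∈ FP`. [folklore] -/
theorem snFn_mem_FP : snFn ∈ FP := append_mem_FP (PolyTimeComputable.id _) (const_mem_FP [true])

/-- `snFn w = encodeNat (sn w)`. [folklore] -/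
theorem snFn_apply (w : List Bool) : snFn w = encodeNat (sn w) := (encodeNat_sn w).symm

/-- Dropping the last symbol: `takeFn ⟨tail z, z⟩ = z ↾ (|z| - 1)`. [folklore] -/
noncomputable def dropLastFn : List Bool → List Bool := Plumb.takeFn ∘ fanoutFn List.tail id

/-- `dropLastFn ∈ FP`. [folklore] -/
theorem dropLastFn_mem_FP : dropLastFn ∈ FP :=
  comp_mem_FP Plumb.takeFn_mem_FP (fanoutFn_mem_FP PRelSigma.tail_mem_FP (PolyTimeComputable.id _))

/-- `dropLastFn z = z.dropLast`. [folklore] -/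
theorem dropLastFn_apply (z : List Bool) : dropLastFn z = z.dropLast := by
  unfold dropLastFn
  rw [Function.comp_apply, fanoutFn_apply, Plumb.takeFn_boolPair, List.length_tail, id, List.dropLast_eq_take]

/-- **The string function of `F`**: `unsn ∘ F ∘ sn`, realised in `FP`. [cite: Cobham1965] -/
noncomputable def strFn {F : ℕ → ℕ} (hF : PV₁ F) : List Bool → List Bool := dropLastFn ∘ numFn hF ∘ snFn

/-- **`strFn F ∈ FP`.** [cite: Cobham1965] -/
theorem strFn_mem_FP {F : ℕ → ℕ} (hF : PV₁ F) : strFn hF ∈ FP :=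
  comp_mem_FP dropLastFn_mem_FP (comp_mem_FP (numFn_mem_FP hF) snFn_mem_FP)

/-- **The value of `strFn F`**: `unsn (F (sn w))`. [cite: Cobham1965] -/
theorem strFn_eq {F : ℕ → ℕ} (hF : PV₁ F) (w : List Bool) : strFn hF w = unsn (F (sn w)) := by
  unfold strFn unsn
  rw [Function.comp_apply, Function.comp_apply, snFn_apply, numFn_encodeNat, dropLastFn_apply]

/-- If `F (sn w) = sn t` then `strFn F w = t`. [cite: Cobham1965] -/
theorem strFn_apply {F : ℕ → ℕ} (hF : PV₁ F) {w t : List Bool} (h : F (sn w) = sn t) : strFn hF w = t := by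
  rw [strFn_eq, h, unsn_sn]

end Literature.Computability.Complexity
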